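import Summits.BirchSwinnertonDyer.BirchSwinnertonDyer.Theorems.KimAtThreeFineKatoPlaceChangeGalois
import Summits.BirchSwinnertonDyer.BirchSwinnertonDyer.Theorems.KimAtThreeFineKatoDefinedLambdaTwist
import Summits.BirchSwinnertonDyer.BirchSwinnertonDyer.Theorems.KimAtThreeFineKatoExpStarGaloisTwo
import HarnessLib

/-!
# PLACE CHANGE of the defined `exp*_{w} ∘ loc^{tower}_{w}`: for two places `w₀, w₁ ∣ p` of `L = ℚ(ζ_m)`,
# **`F_{w₁} = (γ)_* ∘ F_{w₀}`** on `H¹(U, T_pW)` for one `γ ∈ Gal(L/ℚ)` with `γ • w₀ = w₁`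
# (crux `KatoKuriharaPortThreeShared`, stmt-BirchSwinnertonDyer-19560; cell `bsd-addord`, seat w2-acc5 gen 7;
# route W2 `KimAtThreeKolyvagin`; `--supports 19560`, helper)

HONEST FRAMING.  TOOL theorems only (no definition, no named fact, no instance, no `sorry`); every `p`, `k`, `r`;
closes nothing; nothing is booked; BSD / 19560 are NOT proved by any of this.

WHAT.  `F_w := expStarTowerMap … w …` (w2-acc5 gen 6, `KimAtThreeFineKatoDefinedLambdaExpStarDefs`) is the defined scalar
dual exponential `exp*_w` (w2-c2 `expStarOmegaHom`, in the coordinate of a local Néron line `dw` at `L_w` under the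
Prop-1.2.3 binders) of the TOWER localisation `Γ_{L_w} → Γ_{ℚ_v} → Γ_ℚ` of a level class.  The tower is built from the
chosen closure embeddings and lands, for every `w`, in the decomposition group of ONE prime `𝔓₀` of `ℚ̄` above `p`
(`LevelFieldLocalization.absGaloisRestrictTower_mem_decompositionSubgroup`); so `F_{w₀}` and `F_{w₁}` read the SAME
local class, in two fields `L_{w₀} ≅ L_{w₁}` identified through the embeddings.  THIS FILE proves the identity that
follows:

* `exists_towerCocycles_placeChange` — representatives: along the transported restriction `s : Γ_{L_{w₁}} → Γ_{L_{w₀}}`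
  (`res_{w₀} ∘ s = res_{w₁}`, `KimAtThreeFineKatoPlaceChangeGalois`) the tower cocycles of one level class satisfy
  `c₁ τ = c₀ (s τ)`.
* `expStarTowerMap_placeChange` — **∃ `γ`, `γ • w₀ = w₁`, with `F_{w₁} Y = (γ)_* (F_{w₀} Y)` for every
  `Y ∈ H¹(U, T_pW)`**, under (RES₀) for `dw₀` and for `dw₁` relative to ONE line datum `d` at `ℚ_v` and one class with
  `exp*_d ≠ 0`: the inter-completion (GAL_loc) `KimAtThreeFineKatoExpStarGaloisTwo.expStarOmega_galois₂` at `δ' = 1`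
  with `g = (γ)_* = galAdicCompletionMap γ` and the closure-embedding compatibility `e_{w₁} ∘ (γ)_* = e_{w₀}` of
  `KimAtThreeFineKatoPlaceChangeGalois.exists_algEquiv_absEmbedding_galAdicCompletionMap`.

Consequence (sequel `KimAtThreeFineKatoPlaceChange`): `katoLambda … w₁ … = (1 ⊗ γ) ∘ katoLambda … w₀ …` — the defined
value datum DEPENDS on the place through `(1 ⊗ γ)`, which `ZetaBody` absorbs only by moving `ι`, `x` with the chart.

References: K. Kato, LNM 1553 (1993) Ch. II §1.2.4, Prop. 1.2.3 [Kato1993LNM1553]; K. Kato, Astérisque 295 (2004) §9.4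
[Kato2004Asterisque]; J. Neukirch, *ANT* (1999) II §9 (9.6) [NeukirchANT1999]; J.-P. Serre, *Galois Cohomology* (1997)
I §2.4 [SerreGaloisCohomology1997]; J. W. S. Cassels, A. Fröhlich (1967) Ch. VII §1.1 [CasselsFrohlichANT1967].
-/

noncomputable section

-- the cell's Theorems namespace `Summit.BirchSwinnertonDyer.BirchSwinnertonDyer.…` repeats the summit name by design (D-0017)
set_option linter.dupNamespace false

open scoped Classical NumberField ContRepresentation TensorProduct Pointwise
open Field ValuativeRel NumberField IsDedekindDomain
open WeierstrassCurve Literature.NumberTheory.EllipticCurves Literature.NumberTheory.GaloisRepresentations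
  Literature.NumberTheory.GaloisRepresentations.DiscreteGaloisModule
  Literature.NumberTheory.EllipticCurves.Kato2004.EulerSystemValues
open Literature.NumberTheory.GaloisRepresentations.PeriodRingData Literature.NumberTheory.PAdicHodge
open Literature.NumberTheory.AdelicBaseChange Literature.NumberTheory.Automorphic
open Summit.BirchSwinnertonDyer.Rank1Residual.GaloisImage
open Summit.BirchSwinnertonDyer.BirchSwinnertonDyer.Theorems.KimAtThreeFineKatoLevelCompat
open Summit.BirchSwinnertonDyer.BirchSwinnertonDyer.Theorems.KimAtThreeFineKatoLevelCompatDef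
open Summit.BirchSwinnertonDyer.BirchSwinnertonDyer.Theorems.KimAtThreeDeepLowerExpStarOmega
open Summit.BirchSwinnertonDyer.BirchSwinnertonDyer.Theorems.KimAtThreeDeepLowerExpStarOmegaPlace
open Summit.BirchSwinnertonDyer.BirchSwinnertonDyer.Theorems.KimAtThreeDeepLowerExpStarOmegaRes
open Summit.BirchSwinnertonDyer.BirchSwinnertonDyer.Theorems.KimAtThreeFineKatoExpStarGaloisTwo
open Summit.BirchSwinnertonDyer.BirchSwinnertonDyer.Theorems.KimAtThreeFineKatoDefinedLambda
open Summit.BirchSwinnertonDyer.BirchSwinnertonDyer.Theorems.KimAtThreeFineKatoPlaceChangeGalois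

namespace Summit.BirchSwinnertonDyer.BirchSwinnertonDyer.Theorems.KimAtThreeFineKatoPlaceChangeExpStar

/-! ## §1. Representatives along the transported restriction -/

section Representatives

variable (W : WeierstrassCurve ℚ) [W.IsElliptic] (p : ℕ) [hp : Fact p.Prime]
  [ContinuousSMul ℤ_[p] (W.tateModule p)] (k : ℕ) (r : Finset (HeightOneSpectrum (𝓞 ℚ)))
  (v : HeightOneSpectrum (𝓞 ℚ)) (F F' : Type) [Field F] [Field F']
  [Algebra (Place.Completion (Sum.inr v)) F] [Algebra (Place.Completion (Sum.inr v)) F']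

/-- **Representatives for the place change.**  Let the towers `t : Γ_F → Γ_{ℚ_v} → Γ_ℚ`, `t' : Γ_{F'} → Γ_{ℚ_v} → Γ_ℚ`
land in `U = cycSubgroup p k r` and let `s : Γ_{F'} → Γ_F` satisfy `res_F (s τ) = res_{F'} τ`.  For every level class
`Y ∈ H¹(U, T_pW)` there are tower cocycles `c`, `c'` representing `loc^{tower}_F (H1toInt Y)`, `loc^{tower}_{F'} (H1toInt Y)`
with **`c' τ = c (s τ)`** (both are `φ ∘ t`, `φ ∘ t'` for one level cocycle `φ`, and `t ∘ s = t'`).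
[cite: SerreGaloisCohomology1997, I §2.4 (compatible pairs)] -/
theorem exists_towerCocycles_placeChange
    (hU : ∀ τ, absGaloisRestrictTower ℚ (Place.Completion (Sum.inr v)) F τ ∈ cycSubgroup p k r)
    (hU' : ∀ τ, absGaloisRestrictTower ℚ (Place.Completion (Sum.inr v)) F' τ ∈ cycSubgroup p k r)
    (s : absoluteGaloisGroup F' → absoluteGaloisGroup F)
    (hs : ∀ τ, absGaloisRestrict (Place.Completion (Sum.inr v)) F (s τ) = absGaloisRestrict (Place.Completion (Sum.inr v)) F' τ)
    (Y : H1 (tateRep W p) (cycSubgroup p k r)) :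
    ∃ (c : contOneCocycles ((tateLocalRep W p (Sum.inr v)).restrict (absGaloisRestrict (Place.Completion (Sum.inr v)) F)).toTopRep)
      (c' : contOneCocycles ((tateLocalRep W p (Sum.inr v)).restrict (absGaloisRestrict (Place.Completion (Sum.inr v)) F')).toTopRep),
      locTower ℚ (Place.Completion (Sum.inr v)) F (tateRep W p).toIntRep.toTopRep (cycSubgroup p k r) hU 1
          (((tateRep W p).level (cycSubgroup p k r)).H1toInt Y) =
        (show ((tateLocalRep W p (Sum.inr v)).restrict (absGaloisRestrict (Place.Completion (Sum.inr v)) F)).cohomology 1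
          from oneCocycleClass _ c) ∧
      locTower ℚ (Place.Completion (Sum.inr v)) F' (tateRep W p).toIntRep.toTopRep (cycSubgroup p k r) hU' 1
          (((tateRep W p).level (cycSubgroup p k r)).H1toInt Y) =
        (show ((tateLocalRep W p (Sum.inr v)).restrict (absGaloisRestrict (Place.Completion (Sum.inr v)) F')).cohomology 1
          from oneCocycleClass _ c') ∧
      ∀ τ, c'.1 τ = c.1 (s τ) := by
  obtain ⟨φ', rfl⟩ := oneCocycleClass_surjective (subgroupRep (tateRep W p).toTopRep (cycSubgroup p k r)) Y
  obtain ⟨c, hc⟩ := exists_level_towerCocycle W p v F (cycSubgroup p k r) hU φ'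
  obtain ⟨c', hc'⟩ := exists_level_towerCocycle W p v F' (cycSubgroup p k r) hU' φ'
  refine ⟨c, c', locTower_H1toInt_oneCocycleClass W p k r v F hU φ' c hc,
    locTower_H1toInt_oneCocycleClass W p k r v F' hU' φ' c' hc', fun τ => ?_⟩
  rw [hc', hc]
  congr 1
  exact Subtype.ext (absGaloisRestrictTower_eq_of_absGaloisRestrict_eq s hs τ).symm

end Representatives

/-! ## §2. `F_{w₁} = (γ)_* ∘ F_{w₀}` -/

section PlaceChange

variable (W : WeierstrassCurve ℚ) [W.IsElliptic] (p : ℕ) [hp : Fact p.Prime]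
  [ContinuousSMul ℤ_[p] (W.tateModule p)] (k : ℕ) (r : Finset (HeightOneSpectrum (𝓞 ℚ)))
  (w₀ w₁ : ((Rat.HeightOneSpectrum.primesEquiv (R := 𝓞 ℚ)).symm ⟨p, Fact.out⟩).Extension (𝓞 (CyclotomicField (cycLevel p k r) ℚ)))
  (hw₀ : ((p : ℕ) : 𝓞 (CyclotomicField (cycLevel p k r) ℚ)) ∈ w₀.1.asIdeal)
  (hw₁ : ((p : ℕ) : 𝓞 (CyclotomicField (cycLevel p k r) ℚ)) ∈ w₁.1.asIdeal)

set_option backward.isDefEq.respectTransparency false in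
set_option maxHeartbeats 800000 in
/-- **Place change of the defined `exp* ∘ loc^{tower}`** (module docstring): under (RES₀) for `dw₀` at `L_{w₀}` and for
`dw₁` at `L_{w₁}` relative to one line datum `d` at `ℚ_v`, and one class with `exp*_d ≠ 0`, there is `γ ∈ Gal(L/ℚ)`,
`γ • w₀ = w₁`, with `F_{w₁} Y = (γ)_* (F_{w₀} Y)` for every level class `Y` (`expStarOmega_galois₂` at `δ' = 1`, with
`g = galAdicCompletionMap γ` from `exists_algEquiv_absEmbedding_galAdicCompletionMap` and `s` from
`exists_continuousMonoidHom_absGaloisRestrict_eq`; `maxHeartbeats 800000`: two displayed chart blocks and the (GAL_loc)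
instantiation in one proof, as in `katoLambda_eq_of_twist`).
[cite: Kato1993LNM1553, Ch. II §1.2.4 and Prop. 1.2.3] [cite: Kato2004Asterisque, §9.4 (p. 188)]
[cite: NeukirchANT1999, Ch. II §9 Prop. (9.6)] [cite: CasselsFrohlichANT1967, Ch. VII §1.1] -/
theorem expStarTowerMap_placeChange :
    haveI : Fact (((p : ℕ) : 𝓞 ℚ) ∈ ((Rat.HeightOneSpectrum.primesEquiv (R := 𝓞 ℚ)).symm ⟨p, Fact.out⟩).asIdeal) := ⟨(natCast_mem_asIdeal_iff_eq_primesEquiv_symm _ hp.out).mpr rfl⟩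
    letI := valuativeRelPlace ((Rat.HeightOneSpectrum.primesEquiv (R := 𝓞 ℚ)).symm ⟨p, Fact.out⟩)
    letI := topologicalSpacePlace ((Rat.HeightOneSpectrum.primesEquiv (R := 𝓞 ℚ)).symm ⟨p, Fact.out⟩)
    haveI := isNonarchimedeanLocalField_place ((Rat.HeightOneSpectrum.primesEquiv (R := 𝓞 ℚ)).symm ⟨p, Fact.out⟩)
    haveI := charZero_place ((Rat.HeightOneSpectrum.primesEquiv (R := 𝓞 ℚ)).symm ⟨p, Fact.out⟩)
    letI := padicAlgebraPlace p ((Rat.HeightOneSpectrum.primesEquiv (R := 𝓞 ℚ)).symm ⟨p, Fact.out⟩)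
    haveI := fact_not_isUnit_place p ((Rat.HeightOneSpectrum.primesEquiv (R := 𝓞 ℚ)).symm ⟨p, Fact.out⟩)
    haveI := isAdicComplete_place p ((Rat.HeightOneSpectrum.primesEquiv (R := 𝓞 ℚ)).symm ⟨p, Fact.out⟩)
    ∀ (d : LocalNeronLineAt W p ((Rat.HeightOneSpectrum.primesEquiv (R := 𝓞 ℚ)).symm ⟨p, Fact.out⟩))
      (hinj : (bdRPeriodRingData (valuation_place_lt_one p ((Rat.HeightOneSpectrum.primesEquiv (R := 𝓞 ℚ)).symm ⟨p, Fact.out⟩))).CupLogInjective (logCyclotomic p)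
        (localRationalTateRep W p (galRestrictPlace ((Rat.HeightOneSpectrum.primesEquiv (R := 𝓞 ℚ)).symm ⟨p, Fact.out⟩))))
      (hex : ∀ z : contOneCocycles (localRationalTateRep W p (galRestrictPlace ((Rat.HeightOneSpectrum.primesEquiv (R := 𝓞 ℚ)).symm ⟨p, Fact.out⟩))).toTopRep,
        (bdRPeriodRingData (valuation_place_lt_one p ((Rat.HeightOneSpectrum.primesEquiv (R := 𝓞 ℚ)).symm ⟨p, Fact.out⟩))).HasDualExp (logCyclotomic p)
          (localRationalTateRep W p (galRestrictPlace ((Rat.HeightOneSpectrum.primesEquiv (R := 𝓞 ℚ)).symm ⟨p, Fact.out⟩))) fun σ => z.1 σ),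
    (∃ y, expStarOmegaAt d y ≠ 0) →
    letI := LocalField.charZero_adicCompletion w₀.1
    letI := LocalField.adicCompletionPadicAlgebra w₀.1 p hw₀
    haveI : Fact (¬ IsUnit ((p : ℕ) : integerC (w₀.1.adicCompletion (CyclotomicField (cycLevel p k r) ℚ)))) := ⟨not_isUnit_natCast_integerC (LocalField.valuation_adicCompletion_natCast_lt_one w₀.1 p hw₀)⟩
    haveI := isAdicComplete_integerC_natCast (LocalField.valuation_adicCompletion_natCast_lt_one w₀.1 p hw₀)
    ∀ (dw₀ : LocalNeronLine W (LocalField.valuation_adicCompletion_natCast_lt_one w₀.1 p hw₀) ((galRestrictPlace ((Rat.HeightOneSpectrum.primesEquiv (R := 𝓞 ℚ)).symm ⟨p, Fact.out⟩)).comp (absGaloisRestrict (((Rat.HeightOneSpectrum.primesEquiv (R := 𝓞 ℚ)).symm ⟨p, Fact.out⟩).adicCompletion ℚ) (w₀.1.adicCompletion (CyclotomicField (cycLevel p k r) ℚ)))))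
      (hinjw₀ : (bdRPeriodRingData (LocalField.valuation_adicCompletion_natCast_lt_one w₀.1 p hw₀)).CupLogInjective (logCyclotomic p) (localRationalTateRep W p ((galRestrictPlace ((Rat.HeightOneSpectrum.primesEquiv (R := 𝓞 ℚ)).symm ⟨p, Fact.out⟩)).comp (absGaloisRestrict (((Rat.HeightOneSpectrum.primesEquiv (R := 𝓞 ℚ)).symm ⟨p, Fact.out⟩).adicCompletion ℚ) (w₀.1.adicCompletion (CyclotomicField (cycLevel p k r) ℚ))))))
      (hexw₀ : ∀ z : contOneCocycles (localRationalTateRep W p ((galRestrictPlace ((Rat.HeightOneSpectrum.primesEquiv (R := 𝓞 ℚ)).symm ⟨p, Fact.out⟩)).comp (absGaloisRestrict (((Rat.HeightOneSpectrum.primesEquiv (R := 𝓞 ℚ)).symm ⟨p, Fact.out⟩).adicCompletion ℚ) (w₀.1.adicCompletion (CyclotomicField (cycLevel p k r) ℚ))))).toTopRep,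
        (bdRPeriodRingData (LocalField.valuation_adicCompletion_natCast_lt_one w₀.1 p hw₀)).HasDualExp (logCyclotomic p) (localRationalTateRep W p ((galRestrictPlace ((Rat.HeightOneSpectrum.primesEquiv (R := 𝓞 ℚ)).symm ⟨p, Fact.out⟩)).comp (absGaloisRestrict (((Rat.HeightOneSpectrum.primesEquiv (R := 𝓞 ℚ)).symm ⟨p, Fact.out⟩).adicCompletion ℚ) (w₀.1.adicCompletion (CyclotomicField (cycLevel p k r) ℚ))))) fun σ => z.1 σ),
    (∀ (h : (tateLocalRep W p (Sum.inr ((Rat.HeightOneSpectrum.primesEquiv (R := 𝓞 ℚ)).symm ⟨p, Fact.out⟩))).cohomology 1),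
      expStarOmegaHom (LocalField.valuation_adicCompletion_natCast_lt_one w₀.1 p hw₀) ((galRestrictPlace ((Rat.HeightOneSpectrum.primesEquiv (R := 𝓞 ℚ)).symm ⟨p, Fact.out⟩)).comp (absGaloisRestrict (((Rat.HeightOneSpectrum.primesEquiv (R := 𝓞 ℚ)).symm ⟨p, Fact.out⟩).adicCompletion ℚ) (w₀.1.adicCompletion (CyclotomicField (cycLevel p k r) ℚ)))) dw₀ hinjw₀ hexw₀
        (ContinuousRep.cohomologyRes (tateLocalRep W p (Sum.inr ((Rat.HeightOneSpectrum.primesEquiv (R := 𝓞 ℚ)).symm ⟨p, Fact.out⟩))) (absGaloisRestrict (((Rat.HeightOneSpectrum.primesEquiv (R := 𝓞 ℚ)).symm ⟨p, Fact.out⟩).adicCompletion ℚ) (w₀.1.adicCompletion (CyclotomicField (cycLevel p k r) ℚ))) 1 h) =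
      algebraMap (((Rat.HeightOneSpectrum.primesEquiv (R := 𝓞 ℚ)).symm ⟨p, Fact.out⟩).adicCompletion ℚ) (w₀.1.adicCompletion (CyclotomicField (cycLevel p k r) ℚ)) (expStarOmegaAt d h)) →
    letI := LocalField.charZero_adicCompletion w₁.1
    letI := LocalField.adicCompletionPadicAlgebra w₁.1 p hw₁
    haveI : Fact (¬ IsUnit ((p : ℕ) : integerC (w₁.1.adicCompletion (CyclotomicField (cycLevel p k r) ℚ)))) := ⟨not_isUnit_natCast_integerC (LocalField.valuation_adicCompletion_natCast_lt_one w₁.1 p hw₁)⟩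
    haveI := isAdicComplete_integerC_natCast (LocalField.valuation_adicCompletion_natCast_lt_one w₁.1 p hw₁)
    ∀ (dw₁ : LocalNeronLine W (LocalField.valuation_adicCompletion_natCast_lt_one w₁.1 p hw₁) ((galRestrictPlace ((Rat.HeightOneSpectrum.primesEquiv (R := 𝓞 ℚ)).symm ⟨p, Fact.out⟩)).comp (absGaloisRestrict (((Rat.HeightOneSpectrum.primesEquiv (R := 𝓞 ℚ)).symm ⟨p, Fact.out⟩).adicCompletion ℚ) (w₁.1.adicCompletion (CyclotomicField (cycLevel p k r) ℚ)))))
      (hinjw₁ : (bdRPeriodRingData (LocalField.valuation_adicCompletion_natCast_lt_one w₁.1 p hw₁)).CupLogInjective (logCyclotomic p) (localRationalTateRep W p ((galRestrictPlace ((Rat.HeightOneSpectrum.primesEquiv (R := 𝓞 ℚ)).symm ⟨p, Fact.out⟩)).comp (absGaloisRestrict (((Rat.HeightOneSpectrum.primesEquiv (R := 𝓞 ℚ)).symm ⟨p, Fact.out⟩).adicCompletion ℚ) (w₁.1.adicCompletion (CyclotomicField (cycLevel p k r) ℚ))))))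
      (hexw₁ : ∀ z : contOneCocycles (localRationalTateRep W p ((galRestrictPlace ((Rat.HeightOneSpectrum.primesEquiv (R := 𝓞 ℚ)).symm ⟨p, Fact.out⟩)).comp (absGaloisRestrict (((Rat.HeightOneSpectrum.primesEquiv (R := 𝓞 ℚ)).symm ⟨p, Fact.out⟩).adicCompletion ℚ) (w₁.1.adicCompletion (CyclotomicField (cycLevel p k r) ℚ))))).toTopRep,
        (bdRPeriodRingData (LocalField.valuation_adicCompletion_natCast_lt_one w₁.1 p hw₁)).HasDualExp (logCyclotomic p) (localRationalTateRep W p ((galRestrictPlace ((Rat.HeightOneSpectrum.primesEquiv (R := 𝓞 ℚ)).symm ⟨p, Fact.out⟩)).comp (absGaloisRestrict (((Rat.HeightOneSpectrum.primesEquiv (R := 𝓞 ℚ)).symm ⟨p, Fact.out⟩).adicCompletion ℚ) (w₁.1.adicCompletion (CyclotomicField (cycLevel p k r) ℚ))))) fun σ => z.1 σ),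
    (∀ (h : (tateLocalRep W p (Sum.inr ((Rat.HeightOneSpectrum.primesEquiv (R := 𝓞 ℚ)).symm ⟨p, Fact.out⟩))).cohomology 1),
      expStarOmegaHom (LocalField.valuation_adicCompletion_natCast_lt_one w₁.1 p hw₁) ((galRestrictPlace ((Rat.HeightOneSpectrum.primesEquiv (R := 𝓞 ℚ)).symm ⟨p, Fact.out⟩)).comp (absGaloisRestrict (((Rat.HeightOneSpectrum.primesEquiv (R := 𝓞 ℚ)).symm ⟨p, Fact.out⟩).adicCompletion ℚ) (w₁.1.adicCompletion (CyclotomicField (cycLevel p k r) ℚ)))) dw₁ hinjw₁ hexw₁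
        (ContinuousRep.cohomologyRes (tateLocalRep W p (Sum.inr ((Rat.HeightOneSpectrum.primesEquiv (R := 𝓞 ℚ)).symm ⟨p, Fact.out⟩))) (absGaloisRestrict (((Rat.HeightOneSpectrum.primesEquiv (R := 𝓞 ℚ)).symm ⟨p, Fact.out⟩).adicCompletion ℚ) (w₁.1.adicCompletion (CyclotomicField (cycLevel p k r) ℚ))) 1 h) =
      algebraMap (((Rat.HeightOneSpectrum.primesEquiv (R := 𝓞 ℚ)).symm ⟨p, Fact.out⟩).adicCompletion ℚ) (w₁.1.adicCompletion (CyclotomicField (cycLevel p k r) ℚ)) (expStarOmegaAt d h)) →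
    ∃ (γ : CyclotomicField (cycLevel p k r) ℚ ≃ₐ[ℚ] CyclotomicField (cycLevel p k r) ℚ) (hγ : γ • w₀.1 = w₁.1),
      ∀ Y : H1 (tateRep W p) (cycSubgroup p k r),
        expStarTowerMap W p k r w₁ hw₁ dw₁ hinjw₁ hexw₁ Y =
          galAdicCompletionMap γ hγ (expStarTowerMap W p k r w₀ hw₀ dw₀ hinjw₀ hexw₀ Y) := by
  haveI : Fact (((p : ℕ) : 𝓞 ℚ) ∈ ((Rat.HeightOneSpectrum.primesEquiv (R := 𝓞 ℚ)).symm ⟨p, Fact.out⟩).asIdeal) := ⟨(natCast_mem_asIdeal_iff_eq_primesEquiv_symm _ hp.out).mpr rfl⟩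
  letI := valuativeRelPlace ((Rat.HeightOneSpectrum.primesEquiv (R := 𝓞 ℚ)).symm ⟨p, Fact.out⟩)
  letI := topologicalSpacePlace ((Rat.HeightOneSpectrum.primesEquiv (R := 𝓞 ℚ)).symm ⟨p, Fact.out⟩)
  haveI := isNonarchimedeanLocalField_place ((Rat.HeightOneSpectrum.primesEquiv (R := 𝓞 ℚ)).symm ⟨p, Fact.out⟩)
  haveI := charZero_place ((Rat.HeightOneSpectrum.primesEquiv (R := 𝓞 ℚ)).symm ⟨p, Fact.out⟩)
  letI := padicAlgebraPlace p ((Rat.HeightOneSpectrum.primesEquiv (R := 𝓞 ℚ)).symm ⟨p, Fact.out⟩)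
  haveI := fact_not_isUnit_place p ((Rat.HeightOneSpectrum.primesEquiv (R := 𝓞 ℚ)).symm ⟨p, Fact.out⟩)
  haveI := isAdicComplete_place p ((Rat.HeightOneSpectrum.primesEquiv (R := 𝓞 ℚ)).symm ⟨p, Fact.out⟩)
  intro d hinj hex hne
  letI := LocalField.charZero_adicCompletion w₀.1
  letI := LocalField.adicCompletionPadicAlgebra w₀.1 p hw₀
  haveI : Fact (¬ IsUnit ((p : ℕ) : integerC (w₀.1.adicCompletion (CyclotomicField (cycLevel p k r) ℚ)))) := ⟨not_isUnit_natCast_integerC (LocalField.valuation_adicCompletion_natCast_lt_one w₀.1 p hw₀)⟩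
  haveI := isAdicComplete_integerC_natCast (LocalField.valuation_adicCompletion_natCast_lt_one w₀.1 p hw₀)
  intro dw₀ hinjw₀ hexw₀ hres₀
  letI := LocalField.charZero_adicCompletion w₁.1
  letI := LocalField.adicCompletionPadicAlgebra w₁.1 p hw₁
  haveI : Fact (¬ IsUnit ((p : ℕ) : integerC (w₁.1.adicCompletion (CyclotomicField (cycLevel p k r) ℚ)))) := ⟨not_isUnit_natCast_integerC (LocalField.valuation_adicCompletion_natCast_lt_one w₁.1 p hw₁)⟩
  haveI := isAdicComplete_integerC_natCast (LocalField.valuation_adicCompletion_natCast_lt_one w₁.1 p hw₁)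
  intro dw₁ hinjw₁ hexw₁ hres₁
  -- `Place.Completion (inr v)` IS `ℚ_v`: the packet's algebra structures on it
  letI instEF₀ : Algebra (NumberField.Place.Completion (K := ℚ) (Sum.inr ((Rat.HeightOneSpectrum.primesEquiv (R := 𝓞 ℚ)).symm ⟨p, Fact.out⟩))) (w₀.1.adicCompletion (CyclotomicField (cycLevel p k r) ℚ)) := inferInstanceAs (Algebra (((Rat.HeightOneSpectrum.primesEquiv (R := 𝓞 ℚ)).symm ⟨p, Fact.out⟩).adicCompletion ℚ) (w₀.1.adicCompletion (CyclotomicField (cycLevel p k r) ℚ)))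
  letI instEF₁ : Algebra (NumberField.Place.Completion (K := ℚ) (Sum.inr ((Rat.HeightOneSpectrum.primesEquiv (R := 𝓞 ℚ)).symm ⟨p, Fact.out⟩))) (w₁.1.adicCompletion (CyclotomicField (cycLevel p k r) ℚ)) := inferInstanceAs (Algebra (((Rat.HeightOneSpectrum.primesEquiv (R := 𝓞 ℚ)).symm ⟨p, Fact.out⟩).adicCompletion ℚ) (w₁.1.adicCompletion (CyclotomicField (cycLevel p k r) ℚ)))
  have hcont₀ : Continuous (algebraMap (NumberField.Place.Completion (K := ℚ) (Sum.inr ((Rat.HeightOneSpectrum.primesEquiv (R := 𝓞 ℚ)).symm ⟨p, Fact.out⟩))) (w₀.1.adicCompletion (CyclotomicField (cycLevel p k r) ℚ))) := continuous_algebraMap (((Rat.HeightOneSpectrum.primesEquiv (R := 𝓞 ℚ)).symm ⟨p, Fact.out⟩).adicCompletion ℚ) (w₀.1.adicCompletion (CyclotomicField (cycLevel p k r) ℚ))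
  have hcont₁ : Continuous (algebraMap (NumberField.Place.Completion (K := ℚ) (Sum.inr ((Rat.HeightOneSpectrum.primesEquiv (R := 𝓞 ℚ)).symm ⟨p, Fact.out⟩))) (w₁.1.adicCompletion (CyclotomicField (cycLevel p k r) ℚ))) := continuous_algebraMap (((Rat.HeightOneSpectrum.primesEquiv (R := 𝓞 ℚ)).symm ⟨p, Fact.out⟩).adicCompletion ℚ) (w₁.1.adicCompletion (CyclotomicField (cycLevel p k r) ℚ))
  haveI hSTp₀ : IsScalarTower ℚ_[p] (NumberField.Place.Completion (K := ℚ) (Sum.inr ((Rat.HeightOneSpectrum.primesEquiv (R := 𝓞 ℚ)).symm ⟨p, Fact.out⟩))) (w₀.1.adicCompletion (CyclotomicField (cycLevel p k r) ℚ)) :=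
    isScalarTower_padicAlgebra_of_continuous p hcont₀ (valuation_place_lt_one p ((Rat.HeightOneSpectrum.primesEquiv (R := 𝓞 ℚ)).symm ⟨p, Fact.out⟩)) (LocalField.valuation_adicCompletion_natCast_lt_one w₀.1 p hw₀)
  haveI hSTp₁ : IsScalarTower ℚ_[p] (NumberField.Place.Completion (K := ℚ) (Sum.inr ((Rat.HeightOneSpectrum.primesEquiv (R := 𝓞 ℚ)).symm ⟨p, Fact.out⟩))) (w₁.1.adicCompletion (CyclotomicField (cycLevel p k r) ℚ)) :=
    isScalarTower_padicAlgebra_of_continuous p hcont₁ (valuation_place_lt_one p ((Rat.HeightOneSpectrum.primesEquiv (R := 𝓞 ℚ)).symm ⟨p, Fact.out⟩)) (LocalField.valuation_adicCompletion_natCast_lt_one w₁.1 p hw₁)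
  -- the Galois bookkeeping: `γ`, `(γ)_*` compatible with the embeddings, and the transported restriction `s`
  obtain ⟨γ, hγ, hemb⟩ := exists_algEquiv_absEmbedding_galAdicCompletionMap p k r w₀ w₁
  obtain ⟨s, hs⟩ := exists_continuousMonoidHom_absGaloisRestrict_eq p k r w₀ w₁
  have hs' : ∀ τ, absGaloisRestrict (NumberField.Place.Completion (K := ℚ) (Sum.inr ((Rat.HeightOneSpectrum.primesEquiv (R := 𝓞 ℚ)).symm ⟨p, Fact.out⟩))) (w₀.1.adicCompletion (CyclotomicField (cycLevel p k r) ℚ)) (s τ) =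
      (1 : absoluteGaloisGroup (NumberField.Place.Completion (K := ℚ) (Sum.inr ((Rat.HeightOneSpectrum.primesEquiv (R := 𝓞 ℚ)).symm ⟨p, Fact.out⟩))))⁻¹ *
        absGaloisRestrict (NumberField.Place.Completion (K := ℚ) (Sum.inr ((Rat.HeightOneSpectrum.primesEquiv (R := 𝓞 ℚ)).symm ⟨p, Fact.out⟩))) (w₁.1.adicCompletion (CyclotomicField (cycLevel p k r) ℚ)) τ * 1 := fun τ => by
    rw [inv_one, one_mul, mul_one]; exact hs τ
  obtain ⟨y₁, hy₁⟩ := hne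
  have hh₀ : expStarOmega (valuation_place_lt_one p ((Rat.HeightOneSpectrum.primesEquiv (R := 𝓞 ℚ)).symm ⟨p, Fact.out⟩)) (galRestrictPlace ((Rat.HeightOneSpectrum.primesEquiv (R := 𝓞 ℚ)).symm ⟨p, Fact.out⟩)) d y₁ ≠ 0 := hy₁
  refine ⟨γ, hγ, fun Y => ?_⟩
  -- representatives along `s`
  obtain ⟨c₀, c₁, hc₀, hc₁, hcc⟩ := exists_towerCocycles_placeChange W p k r ((Rat.HeightOneSpectrum.primesEquiv (R := 𝓞 ℚ)).symm ⟨p, Fact.out⟩) (w₀.1.adicCompletion (CyclotomicField (cycLevel p k r) ℚ)) (w₁.1.adicCompletion (CyclotomicField (cycLevel p k r) ℚ))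
    (absGaloisRestrictTower_adicCompletion_mem_cycSubgroup_prime p k r w₀)
    (absGaloisRestrictTower_adicCompletion_mem_cycSubgroup_prime p k r w₁) s hs Y
  -- the inter-completion (GAL_loc) at `δ' = 1`
  have key := expStarOmega_galois₂ (K := NumberField.Place.Completion (K := ℚ) (Sum.inr ((Rat.HeightOneSpectrum.primesEquiv (R := 𝓞 ℚ)).symm ⟨p, Fact.out⟩))) (L := (w₀.1.adicCompletion (CyclotomicField (cycLevel p k r) ℚ))) (L' := (w₁.1.adicCompletion (CyclotomicField (cycLevel p k r) ℚ))) (p := p)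
    (valuation_place_lt_one p ((Rat.HeightOneSpectrum.primesEquiv (R := 𝓞 ℚ)).symm ⟨p, Fact.out⟩)) (LocalField.valuation_adicCompletion_natCast_lt_one w₀.1 p hw₀) (LocalField.valuation_adicCompletion_natCast_lt_one w₁.1 p hw₁) W (galRestrictPlace ((Rat.HeightOneSpectrum.primesEquiv (R := 𝓞 ℚ)).symm ⟨p, Fact.out⟩)) hcont₀ hcont₁ 1 s hs'
    (galAdicCompletionMap γ hγ : (w₀.1.adicCompletion (CyclotomicField (cycLevel p k r) ℚ)) →+* (w₁.1.adicCompletion (CyclotomicField (cycLevel p k r) ℚ)))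
    (fun x => galAdicCompletionMap_algebraMap_adicCompletion _ _ w₀ w₁ hγ x)
    (fun y x hyx => by
      rw [one_smul]
      exact absClosureEmbedding_eq_of_absEmbedding_galAdicCompletionMap p k r w₀ w₁ γ hγ hemb y x hyx)
    d dw₀ dw₁ hinjw₀ hexw₀ hinjw₁ (fun y => hres₀ y) (fun y => hres₁ y) y₁ hh₀ c₀ c₁
    (fun τ => by rw [map_one, one_smul]; exact hcc τ)
  -- read on `F_{w₁}`, `F_{w₀}` (no re-elaboration of `loc^{tower}`)
  exact ((expStarTowerMap_apply W p k r w₁ hw₁ dw₁ hinjw₁ hexw₁ Y).trans (congrArg _ hc₁)).trans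
    (key.trans (congrArg (galAdicCompletionMap γ hγ)
      ((expStarTowerMap_apply W p k r w₀ hw₀ dw₀ hinjw₀ hexw₀ Y).trans (congrArg _ hc₀)).symm))

end PlaceChange

end Summit.BirchSwinnertonDyer.BirchSwinnertonDyer.Theorems.KimAtThreeFineKatoPlaceChangeExpStar

end
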